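import Literature.MathematicalPhysics.QuantumFieldTheory.BalabanImbrieJaffe1984to88.BIJ88GaussIntegration309Product
import Literature.MathematicalPhysics.QuantumFieldTheory.BalabanImbrieJaffe1984to88.BIJ88GaussIntegration309Phi
import Mathlib.Probability.Distributions.Gaussian.HasGaussianLaw.Basic

/-!
# `BalabanImbrieJaffe1984to88.BIJ88GaussIntegration309Law` — T. Bałaban, J. Imbrie, A. Jaffe, *Effective action and cluster
properties of the abelian Higgs model*, Commun. Math. Phys. **114** (1988) 257–315 [BalabanImbrieJaffe1988]: p. 309 [PDF 53] (Sect. 5.14,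
proof of (5.14.4)), the located sentences *"the n-th derivative in t of χ(cp(e_k), A^{(k)}) [sic; = χ(cp(te_k), A^{(k)})] is bounded by t^{−n}
times a function bounded by a constant and supported in c₁p(te_k) ≤ |A^{(k)}| ≤ c₂p(te_k). After integration over A^{(k)}, we obtain factors
ct^{−n}e^{−cp(te_k)²} … Similar bounds hold for φ^{(k)}."*

statement-level skeleton of published theorems with citation tags; proofs where landed; nothing here is a claim about the Yang–Mills mass gap

WHAT THIS FILE ADDS to `BIJ88GaussIntegration309` / `BIJ88GaussIntegration309Phi` (gen 5: ONE real Gaussian variable `gaussianReal m v`,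
resp. two INDEPENDENT ones) and to the product bound of `BIJ88GaussIntegration309Product` (this generation, arbitrary law):

* **§3 Gaussian marginals at print generality.**  *"After integration over A^{(k)}"* = expectation in the Gaussian fluctuation measure,
  under which every bond variable `A^{(k)}(b)` has a real Gaussian law.  With Mathlib's `ProbabilityTheory.HasGaussianLaw` (ANY probability
  space, ANY real observable with Gaussian law — e.g. a coordinate of a `multivariateGaussian`, a continuous linear functional of an
  `IsGaussian` measure): the tail `P{a ≤ |X|} ≤ 2e^{−(a−|E X|)²/(2 Var X)}` (`real_abs_ge_le_of_hasGaussianLaw`, pushed forward from gen 5's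
  Chernoff bound), the single-factor sentence `∫|(d/dt)ⁿχ(c·p(te_k),X)|dP ≤ 2C t^{−n} e^{−((9/10)|c|p(te_k)−|EX|)²/(2Var X)}`
  (`integral_abs_iteratedDeriv_cutoff_t_le_of_hasGaussianLaw`), and the product sentence
  `∫|(d/dt)ⁿχ′|dP ≤ (NĈ)ⁿ t^{−n} · 2N · e^{−(81/200)(c₀²/v)p(te_k)²}` for centered Gaussian marginals of variance `≤ v` and `|c_b| ≥ c₀`
  (`integral_abs_iteratedDeriv_prod_cutoff_t_le_of_hasGaussianLaw`) — the printed `ct^{−n}e^{−cp(te_k)²}` for the whole χ′, with no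
  independence and no joint Gaussian structure used.
* **§4 "Similar bounds hold for φ^{(k)}" without independence.**  For the complex field `φ = X + iY` only the marginal laws of `X = Re φ`,
  `Y = Im φ` matter: `P{a ≤ √(X²+Y²)} ≤ 2e^{−a²/(4Var X)} + 2e^{−a²/(4Var Y)}` for centered Gaussian `X`, `Y` on any probability space
  (`real_sqrt_sq_add_sq_ge_le_of_hasGaussianLaw`) and the p. 309 factor for `|φ|` (`integral_abs_iteratedDeriv_cutoff_t_phi_le_of_hasGaussianLaw`).
* **§5 the first located sentence for the whole χ′**, *"Each t-derivative of a χ-factor in χ′_{Λ,t} gives at least a factor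
  e^β(L^kε/ε₀)^{1/4−α}"*: §3's product bound fed into the proved scalar inequality `BIJ88GaussFactor309.gauss309` (gen 4) gives, in the
  printed e_k-small regime, `∫|(d/dt)ⁿχ′|dP ≤ (e^β s^{1/4−α})ⁿ` with `L^kε = sε₀` (`integral_abs_iteratedDeriv_prod_cutoff_t_le_vertexFactor_pow`)
  and, under the stopping rule `Continues` of p. 273, `≤ (e^β (L^kε/ε₀)^{1/4−α})ⁿ` (`…_continues`).

PDF held: `paper:balaban1988-cmp114-bij-abelian-higgs-effective-action` (journal page = PDF page + 256); pp. 308–309 [PDF 52–53] re-read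
this generation (`lit read … --pages 51-54`).

CITATION HEADER (lean-in-tree rule).  Part of the lit-balaban TYPED SKELETON (HOME `run/shared/lean/pub/lit-balaban/`), Phase 2,
seat p36 (gen 7, unit `lit-balaban-p36`); row **C2.Eq5.14.3-5.14.4** of `HOME/lit-balaban-r16/ROWS-C2-part2.md` (owner r16; the typed leaf
(5.14.4) `BIJ88Sect5StatementsPart2.Ineq5144` itself is NOT claimed).  Theorems only; no definitions, no `Prop` facts; axioms standard.
-/

namespace Literature.MathematicalPhysics.QuantumFieldTheory.BalabanImbrieJaffe1984to88.BIJ88GaussIntegration309Law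

open MeasureTheory ProbabilityTheory
open BIJ88Sect2Statements (pLog eK)
open BIJ88Sect5Statements (CutoffProfile cutoff)
open BIJ88GaussIntegration309 (gaussianReal_real_abs_ge_le)
open BIJ88GaussIntegration309Product (integral_abs_iteratedDeriv_prod_cutoff_t_le_measureReal)
open scoped NNReal

/-! ## §3 Gaussian marginals on an arbitrary probability space (`HasGaussianLaw`) -/

section Gaussian

variable {Ω : Type*} [MeasurableSpace Ω] {P : Measure Ω}

/-- **Gaussian tail at print generality**: for ANY real observable `X` with Gaussian law on ANY probability space and `|E X| ≤ a`,
`P{a ≤ |X|} ≤ 2e^{−(a − |E X|)²/(2 Var X)}` (pushed forward from the real-line Chernoff bound of `BIJ88GaussIntegration309`).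
[cite: BalabanImbrieJaffe1988, (5.14.4) p.309] -/
theorem real_abs_ge_le_of_hasGaussianLaw {X : Ω → ℝ} (hX : HasGaussianLaw X P) (hXm : Measurable X) {a : ℝ}
    (ha : |P[X]| ≤ a) :
    P.real {ω | a ≤ |X ω|} ≤ 2 * Real.exp (-(a - |P[X]|) ^ 2 / (2 * Var[X; P])) := by
  have hT : MeasurableSet {x : ℝ | a ≤ |x|} := measurableSet_le measurable_const continuous_abs.measurable
  have hpre : {ω | a ≤ |X ω|} = X ⁻¹' {x : ℝ | a ≤ |x|} := rfl
  have hmap : P.real {ω | a ≤ |X ω|} = (P.map X).real {x : ℝ | a ≤ |x|} := by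
    rw [measureReal_def, measureReal_def, hpre, Measure.map_apply hXm hT]
  rw [hmap, hX.map_eq_gaussianReal]
  have h := gaussianReal_real_abs_ge_le (P[X]) (Var[X; P]).toNNReal ha
  rwa [Real.coe_toNNReal _ (variance_nonneg X P)] at h

/-- Centered Gaussian marginal: `P{a ≤ |X|} ≤ 2e^{−a²/(2 Var X)}` for `E X = 0`, `0 ≤ a`. [cite: BalabanImbrieJaffe1988, (5.14.4) p.309] -/
theorem real_abs_ge_le_of_hasGaussianLaw_centered {X : Ω → ℝ} (hX : HasGaussianLaw X P) (hXm : Measurable X)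
    (h0 : P[X] = 0) {a : ℝ} (ha : 0 ≤ a) :
    P.real {ω | a ≤ |X ω|} ≤ 2 * Real.exp (-(a ^ 2 / (2 * Var[X; P]))) := by
  have h := real_abs_ge_le_of_hasGaussianLaw hX hXm (a := a) (by rw [h0, abs_zero]; exact ha)
  rw [h0, abs_zero, sub_zero, neg_div] at h
  exact h

/-- A variance comparison for the exponential factor: `e^{−a²/(2w)} ≤ e^{−a²/(2v)}` when `0 < w ≤ v`… stated in the direction used below:
for `0 ≤ x` and `0 < v₁ ≤ v₂`, `exp(−x/v₁) ≤ exp(−x/v₂)`. [cite: BalabanImbrieJaffe1988, (5.14.4) p.309] -/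
theorem exp_neg_div_mono {x v₁ v₂ : ℝ} (hx : 0 ≤ x) (hv₁ : 0 < v₁) (hv : v₁ ≤ v₂) :
    Real.exp (-(x / v₁)) ≤ Real.exp (-(x / v₂)) := by
  apply Real.exp_le_exp.mpr
  have : x / v₂ ≤ x / v₁ := div_le_div_of_nonneg_left hx hv₁ hv
  linarith

variable (χ : CutoffProfile)

/-- **p. 309, one χ-factor, ANY Gaussian law** (*"After integration over A^{(k)}, we obtain factors ct^{−n}e^{−cp(te_k)²}"*): for `n ≥ 1`
there is `C = C(χ,p,n) ≥ 0` such that on every probability space, for every measurable real observable `X` with Gaussian law and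
`|E X| ≤ (9/10)|c|p(te_k)`, all `c ≠ 0`, `0 < e_k`, `0 < t`, `te_k ≤ e^{−1}`:
`∫ |(d/dt)ⁿ χ(c·p(te_k), X)| dP ≤ 2C · t^{−n} · e^{−((9/10)|c|p(te_k) − |E X|)²/(2 Var X)}`. [cite: BalabanImbrieJaffe1988, (5.14.4) p.309] -/
theorem integral_abs_iteratedDeriv_cutoff_t_le_of_hasGaussianLaw (p : ℝ) {n : ℕ} (hn : 1 ≤ n) :
    ∃ C : ℝ, 0 ≤ C ∧ ∀ (P : Measure Ω) (X : Ω → ℝ), HasGaussianLaw X P → Measurable X →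
      ∀ ⦃c ek t : ℝ⦄, c ≠ 0 → 0 < ek → 0 < t → t * ek ≤ Real.exp (-1) → |P[X]| ≤ 9 / 10 * (|c| * pLog p (t * ek)) →
        ∫ ω, |iteratedDeriv n (fun s => cutoff χ (c * pLog p (s * ek)) (X ω)) t| ∂P ≤
          2 * C * t ^ (-(n : ℤ)) * Real.exp (-(9 / 10 * (|c| * pLog p (t * ek)) - |P[X]|) ^ 2 / (2 * Var[X; P])) := by
  obtain ⟨C, hC0, hC⟩ := BIJ88GaussIntegration309Phi.integral_abs_iteratedDeriv_cutoff_t_le_measureReal (Ω := Ω) χ p hn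
  refine ⟨C, hC0, ?_⟩
  intro P X hX hXm c ek t hc hek ht h1 hm
  haveI := hX.isProbabilityMeasure
  have h := hC P X hXm hc hek ht h1
  have htail := real_abs_ge_le_of_hasGaussianLaw hX hXm hm
  have hK : 0 ≤ C * t ^ (-(n : ℤ)) := mul_nonneg hC0 (zpow_pos ht _).le
  refine h.trans ((mul_le_mul_of_nonneg_left htail hK).trans (le_of_eq ?_))
  ring

/-- **p. 309 for the whole χ′ with Gaussian marginals** — the printed `ct^{−n}e^{−cp(te_k)²}` for the PRODUCT: for `n₀ ≥ 1` there is
`Ĉ = Ĉ(χ,p,n₀) ≥ 1` such that on every probability space, for every finite family `B` (`N = |B|`) of measurable real observables `Φ_b`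
with CENTERED Gaussian laws of variances `≤ v` (`0 < v`), thresholds `|c_b| ≥ c₀ > 0`, all `0 < e_k`, `0 < t`, `te_k ≤ e^{−1}`, `1 ≤ n ≤ n₀`:
`∫ |(d/dt)ⁿ Π_{b∈B} χ(c_b·p(te_k), Φ_b)| dP ≤ (N·Ĉ)ⁿ t^{−n} · 2N · e^{−(81/200)(c₀²/v)·p(te_k)²}` — no independence and no joint Gaussian
structure is used, only the marginal laws. [cite: BalabanImbrieJaffe1988, (5.14.4) p.309] -/
theorem integral_abs_iteratedDeriv_prod_cutoff_t_le_of_hasGaussianLaw {ι : Type*} (p : ℝ) (n₀ : ℕ) :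
    ∃ C : ℝ, 1 ≤ C ∧ ∀ (P : Measure Ω) [IsProbabilityMeasure P] (B : Finset ι) (Φ : ι → Ω → ℝ) (c : ι → ℝ) (c₀ v : ℝ),
      (∀ b ∈ B, HasGaussianLaw (Φ b) P) → (∀ b ∈ B, Measurable (Φ b)) → (∀ b ∈ B, P[Φ b] = 0) →
      0 < v → (∀ b ∈ B, Var[Φ b; P] ≤ v) → 0 < c₀ → (∀ b ∈ B, c₀ ≤ |c b|) →
      ∀ ⦃ek t : ℝ⦄, 0 < ek → 0 < t → t * ek ≤ Real.exp (-1) → ∀ n, 1 ≤ n → n ≤ n₀ →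
        ∫ ω, |iteratedDeriv n (fun s => ∏ b ∈ B, cutoff χ (c b * pLog p (s * ek)) (Φ b ω)) t| ∂P ≤
          ((B.card : ℝ) * C) ^ n * t ^ (-(n : ℤ)) *
            (2 * B.card * Real.exp (-(81 / 200 * (c₀ ^ 2 / v) * pLog p (t * ek) ^ 2))) := by
  obtain ⟨C, hC1, hC⟩ := integral_abs_iteratedDeriv_prod_cutoff_t_le_measureReal (ι := ι) (Ω := Ω) χ p n₀
  refine ⟨C, hC1, ?_⟩
  intro P _ B Φ c c₀ v hG hΦ h0 hv hvar hc₀ hcb ek t hek ht h1 n hn1 hn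
  have hcne : ∀ b ∈ B, c b ≠ 0 := fun b hb h => by
    have := hcb b hb; rw [h, abs_zero] at this; linarith
  have hmain := hC P B Φ c hΦ hcne hek ht h1 n hn1 hn
  have hK : 0 ≤ ((B.card : ℝ) * C) ^ n * t ^ (-(n : ℤ)) :=
    mul_nonneg (pow_nonneg (mul_nonneg (Nat.cast_nonneg _) (by linarith)) _) (zpow_pos ht _).le
  refine hmain.trans (mul_le_mul_of_nonneg_left ?_ hK)
  -- each marginal tail is ≤ 2e^{−(81/200)(c₀²/v)p(te_k)²}
  have htek : 0 < t * ek := mul_pos ht hek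
  have h1' : t * ek < 1 := h1.trans_lt (by rw [← Real.exp_zero]; exact Real.exp_lt_exp.mpr (by norm_num))
  have hP : 0 ≤ pLog p (t * ek) := Real.rpow_nonneg (abs_nonneg _) p
  have hb : ∀ b ∈ B, P.real {ω | 9 / 10 * (|c b| * pLog p (t * ek)) ≤ |Φ b ω|} ≤
      2 * Real.exp (-(81 / 200 * (c₀ ^ 2 / v) * pLog p (t * ek) ^ 2)) := by
    intro b hbB
    have ha : 0 ≤ 9 / 10 * (|c b| * pLog p (t * ek)) := by positivity
    by_cases hV : Var[Φ b; P] = 0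
    · -- degenerate marginal (variance 0, mean 0): the law is δ₀ and the shell event (threshold > 0) is null
      have hL : 0 < -Real.log (t * ek) := by have := Real.log_neg htek h1'; linarith
      have hT : MeasurableSet {x : ℝ | 9 / 10 * (|c b| * pLog p (t * ek)) ≤ |x|} :=
        measurableSet_le measurable_const continuous_abs.measurable
      have hapos : 0 < 9 / 10 * (|c b| * pLog p (t * ek)) := by
        have hpl : 0 < pLog p (t * ek) := by
          rw [BIJ88ChiTDeriv309.pLog_eq_rpow_neg_log p htek h1']; exact Real.rpow_pos_of_pos hL p
        have hcpos : 0 < |c b| := lt_of_lt_of_le hc₀ (hcb b hbB)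
        positivity
      have hmap : P.map (Φ b) = Measure.dirac 0 := by
        rw [(hG b hbB).map_eq_gaussianReal, h0 b hbB, hV, Real.toNNReal_zero, gaussianReal_zero_var]
      have hzero : P.real {ω | 9 / 10 * (|c b| * pLog p (t * ek)) ≤ |Φ b ω|} = 0 := by
        rw [measureReal_def, show {ω | 9 / 10 * (|c b| * pLog p (t * ek)) ≤ |Φ b ω|} =
          Φ b ⁻¹' {x : ℝ | 9 / 10 * (|c b| * pLog p (t * ek)) ≤ |x|} from rfl, ← Measure.map_apply (hΦ b hbB) hT, hmap,
          Measure.dirac_apply' _ hT, Set.indicator_of_notMem]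
        · simp
        · simp only [Set.mem_setOf_eq, abs_zero, not_le]; exact hapos
      refine le_trans (le_of_eq hzero) ?_
      positivity
    · refine (real_abs_ge_le_of_hasGaussianLaw_centered (hG b hbB) (hΦ b hbB) (h0 b hbB) ha).trans ?_
      refine mul_le_mul_of_nonneg_left ?_ (by norm_num)
      -- compare exponents: (9/10 |c_b| p)²/(2 Var) ≥ (81/200)(c₀²/v) p²
      have hVpos : 0 < Var[Φ b; P] := lt_of_le_of_ne (variance_nonneg _ _) (Ne.symm hV)
      have hx : 0 ≤ (9 / 10 * (|c b| * pLog p (t * ek))) ^ 2 / 2 := by positivity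
      have step1 : Real.exp (-((9 / 10 * (|c b| * pLog p (t * ek))) ^ 2 / (2 * Var[Φ b; P]))) ≤
          Real.exp (-((9 / 10 * (|c b| * pLog p (t * ek))) ^ 2 / (2 * v))) := by
        have e1 : (9 / 10 * (|c b| * pLog p (t * ek))) ^ 2 / (2 * Var[Φ b; P]) =
            ((9 / 10 * (|c b| * pLog p (t * ek))) ^ 2 / 2) / Var[Φ b; P] := by rw [div_div]
        have e2 : (9 / 10 * (|c b| * pLog p (t * ek))) ^ 2 / (2 * v) =
            ((9 / 10 * (|c b| * pLog p (t * ek))) ^ 2 / 2) / v := by rw [div_div]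
        rw [e1, e2]
        exact exp_neg_div_mono hx hVpos (hvar b hbB)
      refine step1.trans (Real.exp_le_exp.mpr ?_)
      rw [neg_le_neg_iff]
      have hv0 : v ≠ 0 := hv.ne'
      have hcc : c₀ ^ 2 ≤ c b ^ 2 := by
        have := pow_le_pow_left₀ hc₀.le (hcb b hbB) 2; rwa [sq_abs] at this
      have hp2 : 0 ≤ pLog p (t * ek) ^ 2 := by positivity
      rw [mul_pow, mul_pow, sq_abs, le_div_iff₀ (by positivity : (0 : ℝ) < 2 * v)]
      have : 81 / 200 * (c₀ ^ 2 / v) * pLog p (t * ek) ^ 2 * (2 * v) = (9 / 10) ^ 2 * (c₀ ^ 2 * pLog p (t * ek) ^ 2) := by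
        field_simp; ring
      rw [this]
      nlinarith [mul_le_mul_of_nonneg_right hcc hp2]
  calc ∑ b ∈ B, P.real {ω | 9 / 10 * (|c b| * pLog p (t * ek)) ≤ |Φ b ω|}
      ≤ ∑ _b ∈ B, 2 * Real.exp (-(81 / 200 * (c₀ ^ 2 / v) * pLog p (t * ek) ^ 2)) := Finset.sum_le_sum hb
    _ = 2 * B.card * Real.exp (-(81 / 200 * (c₀ ^ 2 / v) * pLog p (t * ek) ^ 2)) := by
        rw [Finset.sum_const, nsmul_eq_mul]; ring

end Gaussian

/-! ## §4 *"Similar bounds hold for φ^{(k)}"* — complex field with Gaussian marginals, no independence -/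

section Phi

variable {Ω : Type*} [MeasurableSpace Ω] {P : Measure Ω}

/-- **Tail of the modulus `|φ| = √(X²+Y²)` from the MARGINAL laws only**: for centered Gaussian `X = Re φ`, `Y = Im φ` on any
probability space (no independence, no joint Gaussian structure) and `a ≥ 0`,
`P{a ≤ √(X²+Y²)} ≤ 2e^{−a²/(4 Var X)} + 2e^{−a²/(4 Var Y)}` (union bound over `{|X| ≥ a/√2}`, `{|Y| ≥ a/√2}`).
[cite: BalabanImbrieJaffe1988, (5.14.4) p.309] -/
theorem real_sqrt_sq_add_sq_ge_le_of_hasGaussianLaw {X Y : Ω → ℝ} (hX : HasGaussianLaw X P) (hY : HasGaussianLaw Y P)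
    (hXm : Measurable X) (hYm : Measurable Y) (hX0 : P[X] = 0) (hY0 : P[Y] = 0) {a : ℝ} (ha : 0 ≤ a) :
    P.real {ω | a ≤ Real.sqrt (X ω ^ 2 + Y ω ^ 2)} ≤
      2 * Real.exp (-(a ^ 2 / (4 * Var[X; P]))) + 2 * Real.exp (-(a ^ 2 / (4 * Var[Y; P]))) := by
  haveI := hX.isProbabilityMeasure
  have hsub : {ω | a ≤ Real.sqrt (X ω ^ 2 + Y ω ^ 2)} ⊆ {ω | a / Real.sqrt 2 ≤ |X ω|} ∪ {ω | a / Real.sqrt 2 ≤ |Y ω|} := by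
    intro ω hω
    have h := BIJ88GaussIntegration309Phi.sqrt_sq_add_sq_tail_subset a
      (show (X ω, Y ω) ∈ {q : ℝ × ℝ | a ≤ Real.sqrt (q.1 ^ 2 + q.2 ^ 2)} from hω)
    rcases h with h | h
    · exact Or.inl h.1
    · exact Or.inr h.2
  have ha' : 0 ≤ a / Real.sqrt 2 := by positivity
  have hsq2 : Real.sqrt 2 ^ 2 = 2 := Real.sq_sqrt (by norm_num)
  have e : ∀ w : ℝ, (a / Real.sqrt 2) ^ 2 / (2 * w) = a ^ 2 / (4 * w) := fun w => by rw [div_pow, hsq2]; ring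
  have hX' := real_abs_ge_le_of_hasGaussianLaw_centered hX hXm hX0 ha'
  have hY' := real_abs_ge_le_of_hasGaussianLaw_centered hY hYm hY0 ha'
  rw [e] at hX' hY'
  calc P.real {ω | a ≤ Real.sqrt (X ω ^ 2 + Y ω ^ 2)}
      ≤ P.real ({ω | a / Real.sqrt 2 ≤ |X ω|} ∪ {ω | a / Real.sqrt 2 ≤ |Y ω|}) := measureReal_mono hsub
    _ ≤ P.real {ω | a / Real.sqrt 2 ≤ |X ω|} + P.real {ω | a / Real.sqrt 2 ≤ |Y ω|} := measureReal_union_le _ _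
    _ ≤ 2 * Real.exp (-(a ^ 2 / (4 * Var[X; P]))) + 2 * Real.exp (-(a ^ 2 / (4 * Var[Y; P]))) := add_le_add hX' hY'

variable (χ : CutoffProfile)

/-- **p. 309 for φ^{(k)}, ANY law with Gaussian marginals**: for `n ≥ 1` there is `C = C(χ,p,n) ≥ 0` such that on every probability space, for
all measurable `X`, `Y` with centered Gaussian laws (the real and imaginary parts of `φ^{(k)}(x)`; no independence assumed), all `c ≠ 0`,
`0 < e_k`, `0 < t`, `te_k ≤ e^{−1}`:
`∫ |(d/dt)ⁿ χ(c·p(te_k), √(X²+Y²))| dP ≤ 2C t^{−n} (e^{−((81/400)c²/Var X)p(te_k)²} + e^{−((81/400)c²/Var Y)p(te_k)²})`.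
[cite: BalabanImbrieJaffe1988, (5.14.4) p.309] -/
theorem integral_abs_iteratedDeriv_cutoff_t_phi_le_of_hasGaussianLaw (p : ℝ) {n : ℕ} (hn : 1 ≤ n) :
    ∃ C : ℝ, 0 ≤ C ∧ ∀ (P : Measure Ω) (X Y : Ω → ℝ), HasGaussianLaw X P → HasGaussianLaw Y P → Measurable X → Measurable Y →
      P[X] = 0 → P[Y] = 0 → ∀ ⦃c ek t : ℝ⦄, c ≠ 0 → 0 < ek → 0 < t → t * ek ≤ Real.exp (-1) →
        ∫ ω, |iteratedDeriv n (fun s => cutoff χ (c * pLog p (s * ek)) (Real.sqrt (X ω ^ 2 + Y ω ^ 2))) t| ∂P ≤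
          2 * C * t ^ (-(n : ℤ)) *
            (Real.exp (-(81 / 400 * c ^ 2 / Var[X; P] * pLog p (t * ek) ^ 2)) +
              Real.exp (-(81 / 400 * c ^ 2 / Var[Y; P] * pLog p (t * ek) ^ 2))) := by
  obtain ⟨C, hC0, hC⟩ := BIJ88GaussIntegration309Phi.integral_abs_iteratedDeriv_cutoff_t_le_measureReal (Ω := Ω) χ p hn
  refine ⟨C, hC0, ?_⟩
  intro P X Y hX hY hXm hYm hX0 hY0 c ek t hc hek ht h1
  haveI := hX.isProbabilityMeasure
  have hΦ : Measurable fun ω => Real.sqrt (X ω ^ 2 + Y ω ^ 2) :=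
    Real.continuous_sqrt.measurable.comp ((hXm.pow_const 2).add (hYm.pow_const 2))
  have h := hC P (fun ω => Real.sqrt (X ω ^ 2 + Y ω ^ 2)) hΦ hc hek ht h1
  have hP : 0 ≤ |c| * pLog p (t * ek) := mul_nonneg (abs_nonneg c) (Real.rpow_nonneg (abs_nonneg _) p)
  have ha : 0 ≤ 9 / 10 * (|c| * pLog p (t * ek)) := by positivity
  have hset : {ω | 9 / 10 * (|c| * pLog p (t * ek)) ≤ |Real.sqrt (X ω ^ 2 + Y ω ^ 2)|} =
      {ω | 9 / 10 * (|c| * pLog p (t * ek)) ≤ Real.sqrt (X ω ^ 2 + Y ω ^ 2)} := by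
    ext ω
    simp only [Set.mem_setOf_eq, abs_of_nonneg (Real.sqrt_nonneg _)]
  rw [hset] at h
  have htail := real_sqrt_sq_add_sq_ge_le_of_hasGaussianLaw hX hY hXm hYm hX0 hY0 ha
  have hK : 0 ≤ C * t ^ (-(n : ℤ)) := mul_nonneg hC0 (zpow_pos ht _).le
  refine h.trans ((mul_le_mul_of_nonneg_left htail hK).trans (le_of_eq ?_))
  have e : ∀ w : ℝ, -((9 / 10 * (|c| * pLog p (t * ek))) ^ 2 / (4 * w)) = -(81 / 400 * c ^ 2 / w * pLog p (t * ek) ^ 2) := by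
    intro w
    rw [mul_pow, mul_pow, sq_abs]
    ring
  rw [e, e]
  ring

end Phi

/-! ## §5 The first located sentence for the whole χ′: *"Each t-derivative of a χ-factor in χ′_{Λ,t} gives at least a factor
e^β(L^kε/ε₀)^{1/4−α}"* — §3's product bound fed into `BIJ88GaussFactor309.gauss309` -/

section Vertex

variable {Ω : Type*} [MeasurableSpace Ω] (χ : CutoffProfile)

/-- **p. 309, the complete sentence for the product χ′ with Gaussian marginals** (charge reading of `e^β`, as in gen 5's one-variable
`BIJ88GaussIntegration309.exists_integral_le_vertexFactor_pow`): with `e_k = eK L ε e d k` (2.2), `L^kε = sε₀` (`0 < s ≤ 1`, `0 < ε₀ ≤ 1`),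
`0 < e ≤ 1`, `β ≤ 1`, `0 ≤ α`, `d < 4`, `1/2 < p`, `0 < t ≤ 1`, `e_k ≤ e^{−1}`, centered Gaussian marginals of variances `≤ v`, thresholds
`|c_b| ≥ c₀ > 0`, and the printed e_k-small regime `n + 1 ≤ (81c₀²/(200v))|log e_k⁻¹|^{2p−1}`, `2N(NĈ)ⁿ·e_k ≤ 1`:
`∫ |(d/dt)ⁿ Π_{b∈B} χ(c_b·p(te_k), Φ_b)| dP ≤ (e^β s^{1/4−α})ⁿ` — n t-derivatives of χ′ give n vertex factors.
[cite: BalabanImbrieJaffe1988, (5.14.4) p.309] -/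
theorem integral_abs_iteratedDeriv_prod_cutoff_t_le_vertexFactor_pow {ι : Type*} (p : ℝ) (n₀ : ℕ) :
    ∃ C : ℝ, 1 ≤ C ∧ ∀ (P : Measure Ω) [IsProbabilityMeasure P] (B : Finset ι) (Φ : ι → Ω → ℝ) (c : ι → ℝ) (c₀ v : ℝ)
      ⦃L ε e s ε₀ t α β : ℝ⦄ ⦃d k : ℕ⦄,
      (∀ b ∈ B, HasGaussianLaw (Φ b) P) → (∀ b ∈ B, Measurable (Φ b)) → (∀ b ∈ B, P[Φ b] = 0) →
      0 < v → (∀ b ∈ B, Var[Φ b; P] ≤ v) → 0 < c₀ → (∀ b ∈ B, c₀ ≤ |c b|) →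
      0 < L → 0 < ε → 0 < e → e ≤ 1 → β ≤ 1 → 0 ≤ α → d < 4 → 0 < s → s ≤ 1 → 0 < ε₀ → ε₀ ≤ 1 → L ^ k * ε = s * ε₀ →
      0 < t → t ≤ 1 → 1 / 2 < p → eK L ε e d k ≤ Real.exp (-1) →
      ∀ n, 1 ≤ n → n ≤ n₀ →
        (n : ℝ) + 1 ≤ 81 / 200 * (c₀ ^ 2 / v) * Real.log (eK L ε e d k)⁻¹ ^ (2 * p - 1) →
        2 * B.card * ((B.card : ℝ) * C) ^ n * eK L ε e d k ≤ 1 →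
          ∫ ω, |iteratedDeriv n (fun σ => ∏ b ∈ B, cutoff χ (c b * pLog p (σ * eK L ε e d k)) (Φ b ω)) t| ∂P ≤
            (e ^ β * s ^ (1 / 4 - α)) ^ n := by
  obtain ⟨C, hC1, hC⟩ := integral_abs_iteratedDeriv_prod_cutoff_t_le_of_hasGaussianLaw (Ω := Ω) (ι := ι) χ p n₀
  refine ⟨C, hC1, ?_⟩
  intro P _ B Φ c c₀ v L ε e s ε₀ t α β d k hG hΦ h0 hv hvar hc₀ hcb hL hε he0 he1 hβ1 hα hd hs0 hs1 hε₀0 hε₀1 hLε ht0 ht1 hp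
    hek1 n hn1 hn hreg hsmall
  have hek : 0 < eK L ε e d k := BIJ88ScaleSums.eK_pos hL hε he0 k
  have h1 : t * eK L ε e d k ≤ Real.exp (-1) := (mul_le_of_le_one_left hek.le ht1).trans hek1
  refine (hC P B Φ c c₀ v hG hΦ h0 hv hvar hc₀ hcb hek ht0 h1 n hn1 hn).trans ?_
  have hC0 : 0 ≤ C := by linarith
  have hg := BIJ88GaussFactor309.gauss309 (n := n) (c' := 2 * B.card * ((B.card : ℝ) * C) ^ n) (c := 81 / 200 * (c₀ ^ 2 / v))
    hL hε he0 he1 hβ1 hα hd hs0 hs1 hε₀0 hε₀1 hLε ht0 ht1 hp (by positivity) (by positivity) hreg hsmall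
  refine le_trans (le_of_eq ?_) hg
  rw [zpow_neg, zpow_natCast, div_eq_mul_inv]
  ring

/-- **The same under the stopping rule of p. 273** (`Continues L ε ε₀ k`: L^kε < ε₀ ≤ 1, s = L^kε/ε₀):
`∫ |(d/dt)ⁿ χ′| dP ≤ (e^β (L^kε/ε₀)^{1/4−α})ⁿ`, hypotheses as above. [cite: BalabanImbrieJaffe1988, (5.14.4) p.309; (4.1) p.273] -/
theorem integral_abs_iteratedDeriv_prod_cutoff_t_le_vertexFactor_pow_continues {ι : Type*} (p : ℝ) (n₀ : ℕ) :
    ∃ C : ℝ, 1 ≤ C ∧ ∀ (P : Measure Ω) [IsProbabilityMeasure P] (B : Finset ι) (Φ : ι → Ω → ℝ) (c : ι → ℝ) (c₀ v : ℝ)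
      ⦃L ε e ε₀ t α β : ℝ⦄ ⦃d k : ℕ⦄,
      (∀ b ∈ B, HasGaussianLaw (Φ b) P) → (∀ b ∈ B, Measurable (Φ b)) → (∀ b ∈ B, P[Φ b] = 0) →
      0 < v → (∀ b ∈ B, Var[Φ b; P] ≤ v) → 0 < c₀ → (∀ b ∈ B, c₀ ≤ |c b|) →
      0 < L → 0 < ε → 0 < e → e ≤ 1 → β ≤ 1 → 0 ≤ α → d < 4 → BIJ88Sect4Statements.Continues L ε ε₀ k → ε₀ ≤ 1 →
      0 < t → t ≤ 1 → 1 / 2 < p → eK L ε e d k ≤ Real.exp (-1) →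
      ∀ n, 1 ≤ n → n ≤ n₀ →
        (n : ℝ) + 1 ≤ 81 / 200 * (c₀ ^ 2 / v) * Real.log (eK L ε e d k)⁻¹ ^ (2 * p - 1) →
        2 * B.card * ((B.card : ℝ) * C) ^ n * eK L ε e d k ≤ 1 →
          ∫ ω, |iteratedDeriv n (fun σ => ∏ b ∈ B, cutoff χ (c b * pLog p (σ * eK L ε e d k)) (Φ b ω)) t| ∂P ≤
            (e ^ β * (L ^ k * ε / ε₀) ^ (1 / 4 - α)) ^ n := by
  obtain ⟨C, hC1, hC⟩ := integral_abs_iteratedDeriv_prod_cutoff_t_le_vertexFactor_pow (Ω := Ω) (ι := ι) χ p n₀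
  refine ⟨C, hC1, ?_⟩
  intro P _ B Φ c c₀ v L ε e ε₀ t α β d k hG hΦ h0 hv hvar hc₀ hcb hL hε he0 he1 hβ1 hα hd hcont hε₀1 ht0 ht1 hp
    hek1 n hn1 hn hreg hsmall
  unfold BIJ88Sect4Statements.Continues at hcont
  have hLε : 0 < L ^ k * ε := by positivity
  have hε₀0 : 0 < ε₀ := hLε.trans hcont
  have hs0 : 0 < L ^ k * ε / ε₀ := div_pos hLε hε₀0
  have hs1 : L ^ k * ε / ε₀ ≤ 1 := by rw [div_le_one hε₀0]; exact hcont.le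
  have hLε' : L ^ k * ε = L ^ k * ε / ε₀ * ε₀ := by field_simp
  exact hC P B Φ c c₀ v hG hΦ h0 hv hvar hc₀ hcb hL hε he0 he1 hβ1 hα hd hs0 hs1 hε₀0 hε₀1 hLε' ht0 ht1 hp hek1 n hn1 hn hreg hsmall

end Vertex

end Literature.MathematicalPhysics.QuantumFieldTheory.BalabanImbrieJaffe1984to88.BIJ88GaussIntegration309Law
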